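import Mathlib
import Summits.AnomalousDissipation.AnomalousDissipation.Theses.PointSink
import Summits.AnomalousDissipation.AnomalousDissipation.Theorems.SolitonTransplant.Negative.PointSinkTameNoGo
import Summits.AnomalousDissipation.AnomalousDissipation.Theorems.SolitonTransplant.Negative.AntecedentRedundancy
import Summits.AnomalousDissipation.AnomalousDissipation.Theorems.SolitonTransplant.Negative.AntecedentEnvelope
import Summits.AnomalousDissipation.AnomalousDissipation.Theorems.SolitonTransplant.Negative.PointSinkLocalEnergy
import Summits.AnomalousDissipation.AnomalousDissipation.Theorems.SolitonTransplant.Negative.PointSinkBoundedNoGo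
import Summits.AnomalousDissipation.AnomalousDissipation.Theorems.SolitonTransplant.Negative.PointSinkLqEstimates
import Summits.AnomalousDissipation.AnomalousDissipation.Theorems.SolitonTransplant.Negative.PointSinkLqNoGo
import Summits.AnomalousDissipation.AnomalousDissipation.Theorems.CoherentStatesSteadyNegTameOffThinSets
import Literature.Barriers.AnomalousDissipation.ClassicalEulerLimitProofs

/-!
# Disproof of `PointSink.SolitonTransplant` (stmt-AnomalousDissipation-19035) — findings

cdisprove work file (refuter-cdisprove-stmt-AnomalousDissipation-19035-0, cycle 1, 2026-08-17; v5 = index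
version: everything conclusive is LANDED under `Theorems/SolitonTransplant/Negative/` and re-exported here by
name; v1–v4 carried the same content inline).
Crux: `SolitonTransplant := (CascadeSoliton body, verbatim) → PointSinkZerothLaw`.

## Verdict of cycle 1: NO KILL — and none is possible from this seat
* §0 `solitonTransplant_iff` (`Iff.rfl`): the crux IS `CascadeSoliton → PointSinkZerothLaw`
  (`solitonTransplant_iff_not_or`: it holds iff `¬CascadeSoliton ∨ PointSinkZerothLaw`); hence
  `not_solitonTransplant_iff`: `¬ crux ↔ CascadeSoliton ∧ ¬ PointSinkZerothLaw`. An unconditional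
  refutation must therefore PROVE `CascadeSoliton` (stmt-19036: a non-trivial smooth steady unforced
  D-solution on `ℝ³` in the critical `L²`-mass class `R^{5/3}` with a DSS(−2/3) blow-down — i.e. the
  FAILURE of Galdi's Liouville problem in that class; open, and the consensus expects Liouville to hold,
  which would make the crux vacuously TRUE) and ALSO refute the target `X = PointSinkZerothLaw` (a
  strengthening of `CoherentStates.SteadyZerothLaw`, stmt-0219, open in both directions). Neither half is
  constructible/refutable here: the crux resists for STRUCTURAL reasons, not for lack of attacks.
* No formalisation junk found in either side: both `IsClassicalNSSolutionOn` notions are the honest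
  four-field structures; all integrals in `X` are of smooth functions on the compact torus; the shell
  integrals of the antecedent are of `L²_loc` data on compact shells.

## §1 Load-bearing analysis of the ANTECEDENT (conjuncts (1) NS, (2) envelope, (3) `|∇Q|² ∈ L¹`,
## (4) `0 < ∫|∇Q|²`, (5) non-trivial DSS far field) — LANDED
* (3), (4) NOT load-bearing: `Negative/AntecedentRedundancy.lean` (p161030) — `integrable_gradSq_of_pos`,
  `dissipation_pos_of_farField`, `solitonTransplant_iff_without_pos`, `solitonTransplant_iff_without_integrable`.
* (2) NOT load-bearing: `Negative/AntecedentEnvelope.lean` (p163026) — `envelope_of_farField`,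
  `solitonTransplant_iff_minimal`: the crux ↔ the implication from (1) ∧ (3) ∧ (5), "a D-solution with zero
  force whose blow-down converges in normalised `L²`-shell sense to a non-trivial DSS(−2/3) profile".
* (1) IS load-bearing (paper): without the Navier–Stokes equation the antecedent is inhabited by
  `Q := 𝟙_{‖x‖ ≥ 1} ‖x‖^{-2/3} e₁`, `V := ‖x‖^{-2/3} e₁` (every `λ > 1`; `fderiv` junk `0` on the null unit
  sphere), so the crux without (1) is the bare target `X` (not formalised: no information for provers).
* (5) dropped: antecedent = "non-trivial D-solution with `R^{5/3}` envelope" = ¬(Liouville in the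
  `L²`-mass class) (NS summit `GaldiLiouvilleGate`/`DSolutionBubble`, stmt-NavierStokesRegularity-0897/0898):
  open both ways.

## §2 The CONCLUSION `X = PointSinkZerothLaw`: what every proof must respect
* Tightness (proved here): `floor_le_sqrt_force_mul_sqrt_energy` (`ε ≤ √(∫‖f‖²)·√E`), `enstrophy_ge` /
  `enstrophy_tendsto_atTop` (`‖∇u_j‖₂² ≥ ε/ν_j → ∞`), `not_frozen_state`.
* Tame no-go (earlier seat, p142855): `Negative.dissipationFloor_false_of_tame(_singleton)` — a limit that is a
  steady Euler pair `C¹` off a codimension-≥2 closed set carries no floor.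
* Weighted steady energy identity (p162118, `Negative/PointSinkLocalEnergy.lean`):
  `∫(½‖u‖²+p)Dψ[u] = ν∫ψ∑‖∂ᵢu‖² + ν∫∑∂ᵢψ⟪u,∂ᵢu⟫ − ∫ψ⟪f,u⟫` for steady classical states on `T^d`.
* NO BOUNDED POINT SINK (p162345, `Negative/PointSinkBoundedNoGo.lean`): `X` with `‖u_j‖,|p_j| ≤ M` is FALSE;
  the De Rosa–Drivas–Inversi barrier (`DeRosaDrivasInversi2024_thm12/19_bounded`) can never be instantiated on a
  witness — its evasion by unboundedness is FORCED.
* NO `L^q × L^{q/2}`-BOUNDED POINT SINK FOR ANY `q > 9/2` (p162982 estimates + p163407,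
  `Negative/PointSinkLqNoGo.lean`): Hölder flux `≲ C^{3/q} r^{2−9/q} → 0` iff `q > 9/2`. SHARP: the route's own
  witness `|u_j| ≍ dist^{-2/3}` is uniformly `L^q` exactly for `q < 9/2` — the torus-side twin of Galdi's
  `L^{9/2}` Liouville borderline and of the `p = 9/2` endpoint of De Rosa–Isett. Every proof of the crux must
  produce states at least as singular as the `-2/3` cone in the `L^q` scale; every "smoothed" variant of the
  transplant (mollified cone, bounded completion, `L^{9/2+}` core) is dead on arrival.
* Open sharpenings (not landed): velocity-only unboundedness (needs an `L²` pressure bound on `T³`: double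
  Riesz transform of `u ⊗ u`, i.e. Parseval for the pressure Poisson equation); the piecewise-smooth (codimension-1
  tangential-sheet) extension of the tame no-go (ideator NegNote Claim B; needs one-sided traces on the torus).
* Idea cards of this crux (`viscosity-ladder`, `mollifier-ladder-subsolution`) keep the singular `dist^{-2/3}`
  core and are CONSISTENT with all of the above (no kill); the `L^q` lemma is a design constraint for both.

## §3 Targets (lead's stuck stubs): none this cycle (no line picked yet).

## Barrier catalogue check (Literature/Barriers/AnomalousDissipation)
DRDI thm12/thm19 (bounded families): evaded by unboundedness — §2 PROVES the evasion is necessary. De Rosa–Isett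
thm213 / DRDI–Isett cor51: saturated at `p = 9/2` (§2 reproduces the exponent on the torus), no uniform Besov bound
is claimed by `X`. DeRosaInversi thm12 (BV ∩ L^∞): escaping hypothesis `L^∞`. MeasureValuedWeakStrong /
ClassicalEulerLimit (Brué–De Lellis Lemma 7): need a smooth Euler solution of the limit problem — the sink limit is
singular at `x₀`. ShearFlowViscositySelection, TwoDimensional*, GravestMode*: different settings. None bites `X`.
Literature (lit search 2026-08-17, remote tiers 429): no printed no-go for STEADY forced 3D zeroth law / point sinks.
-/

set_option linter.dupNamespace false

noncomputable section

open MeasureTheory Metric Filter Topology Set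
open scoped InnerProductSpace
open Literature.Analysis.FunctionSpaces

namespace Summit.AnomalousDissipation.AnomalousDissipation.Cruxes.SolitonTransplant.Disproof

open Summit.AnomalousDissipation.AnomalousDissipation.Theses.PointSink

/-! ## §0 Logical skeleton: why no unconditional kill exists -/

/-- The crux is literally `CascadeSoliton → PointSinkZerothLaw`. [folklore] -/
theorem solitonTransplant_iff : SolitonTransplant ↔ (CascadeSoliton → PointSinkZerothLaw) := Iff.rfl

/-- The crux holds iff Liouville holds in the cascade-soliton class OR the target holds: either
`¬ CascadeSoliton` (vacuous antecedent — the consensus expectation) or `PointSinkZerothLaw` alone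
proves it. [folklore] -/
theorem solitonTransplant_iff_not_or : SolitonTransplant ↔ (¬ CascadeSoliton ∨ PointSinkZerothLaw) :=
  imp_iff_not_or

/-- A refutation is exactly a cascade soliton together with a refutation of the target. [folklore] -/
theorem not_solitonTransplant_iff : ¬ SolitonTransplant ↔ (CascadeSoliton ∧ ¬ PointSinkZerothLaw) :=
  Classical.not_imp

/-! ## §1 Load-bearing analysis of the antecedent — landed lemmas, re-exported by name -/

/-- (4) ⇒ (3). Landed: `Negative.integrable_gradSq_of_pos` (p161030). [folklore] -/
alias integrable_gradSq_of_pos := Summit.AnomalousDissipation.AnomalousDissipation.Theorems.SolitonTransplant.Negative.integrable_gradSq_of_pos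

/-- (1) ∧ (2) ∧ (3) ∧ (5) ⇒ (4). Landed: `Negative.dissipation_pos_of_farField` (p161030). [folklore] -/
alias dissipation_pos_of_farField := Summit.AnomalousDissipation.AnomalousDissipation.Theorems.SolitonTransplant.Negative.dissipation_pos_of_farField

/-- continuity ∧ (5) ⇒ (2). Landed: `Negative.envelope_of_farField` (p163026). [folklore] -/
alias envelope_of_farField := Summit.AnomalousDissipation.AnomalousDissipation.Theorems.SolitonTransplant.Negative.envelope_of_farField

/-- The crux ↔ the crux with (4) deleted. Landed (p161030). [folklore] -/
alias solitonTransplant_iff_without_pos := Summit.AnomalousDissipation.AnomalousDissipation.Theorems.SolitonTransplant.Negative.solitonTransplant_iff_without_pos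

/-- The crux ↔ the crux with (3) deleted. Landed (p161030). [folklore] -/
alias solitonTransplant_iff_without_integrable := Summit.AnomalousDissipation.AnomalousDissipation.Theorems.SolitonTransplant.Negative.solitonTransplant_iff_without_integrable

/-- **Minimal antecedent**: the crux ↔ the implication from (1) ∧ (3) ∧ (5). Landed (p163026). [folklore] -/
alias solitonTransplant_iff_minimal := Summit.AnomalousDissipation.AnomalousDissipation.Theorems.SolitonTransplant.Negative.solitonTransplant_iff_minimal

/-! ## §2 The conclusion `X = PointSinkZerothLaw`: tightness and refuted strengthenings -/

/-- **Tightness of the floor (proved).** In the setting of `X` (steady classical states of the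
`f`-forced system with `∫‖u_j‖² ≤ E` and floor `ε ≤ ν_j‖∇u_j‖₂²`), necessarily `ε ≤ √(∫‖f‖²)·√E`:
the floor is the work of the stirring, `ν_j‖∇u_j‖₂² = ∫⟪f,u_j⟫ ≤ ‖f‖₂‖u_j‖₂`. Any strengthening of
`X` with `ε² > E∫‖f‖²` is false. [folklore] -/
theorem floor_le_sqrt_force_mul_sqrt_energy
    {f : UnitAddTorus (Fin 3) → EuclideanSpace ℝ (Fin 3)} (hf : Torus.IsSmooth f)
    {ν : ℕ → ℝ} {u : ℕ → UnitAddTorus (Fin 3) → EuclideanSpace ℝ (Fin 3)}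
    {p : ℕ → UnitAddTorus (Fin 3) → ℝ}
    (hsol : ∀ j, Torus.IsClassicalNSSolutionOn Set.univ (ν j) (fun _ => f) (fun _ => u j)
      (fun _ => p j))
    {E : ℝ} (hE : ∀ j, ∫ x, ‖u j x‖ ^ 2 ≤ E) {ε : ℝ} (hε : ∀ j, ε ≤ ν j * Torus.gradNormSq (u j)) :
    ε ≤ Real.sqrt (∫ x, ‖f x‖ ^ 2) * Real.sqrt E := by
  have hid :=
    Summit.AnomalousDissipation.AnomalousDissipation.Theorems.CoherentStates.steady_energy_identity
      (hsol 0)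
  have hu : Continuous (u 0) :=
    ((hsol 0).smooth_velocity.isSmooth_slice (Set.mem_univ (0 : ℝ))).continuous
  have hcs := Literature.Barriers.AnomalousDissipation.Torus.abs_integral_inner_le_sqrt_mul_sqrt
    hf.continuous hu
  calc ε ≤ ν 0 * Torus.gradNormSq (u 0) := hε 0
    _ = ∫ x, ⟪f x, u 0 x⟫_ℝ := hid
    _ ≤ |∫ x, ⟪f x, u 0 x⟫_ℝ| := le_abs_self _
    _ ≤ Real.sqrt (∫ x, ‖f x‖ ^ 2) * Real.sqrt (∫ x, ‖u 0 x‖ ^ 2) := hcs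
    _ ≤ Real.sqrt (∫ x, ‖f x‖ ^ 2) * Real.sqrt E := by
        gcongr
        exact hE 0

/-- **The floor costs enstrophy `≥ ε/ν_j` (proved).** [folklore] -/
theorem enstrophy_ge {ν : ℕ → ℝ} (hν : ∀ j, 0 < ν j)
    {u : ℕ → UnitAddTorus (Fin 3) → EuclideanSpace ℝ (Fin 3)}
    {ε : ℝ} (hε : ∀ j, ε ≤ ν j * Torus.gradNormSq (u j)) (j : ℕ) :
    ε / ν j ≤ Torus.gradNormSq (u j) := by
  rw [div_le_iff₀ (hν j), mul_comm]
  exact hε j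

/-- **Hence `‖∇u_j‖₂² → ∞` along any floor-carrying vanishing-viscosity family (proved).** [folklore] -/
theorem enstrophy_tendsto_atTop {ν : ℕ → ℝ} (hν : ∀ j, 0 < ν j) (hν0 : Tendsto ν atTop (𝓝 0))
    {u : ℕ → UnitAddTorus (Fin 3) → EuclideanSpace ℝ (Fin 3)}
    {ε : ℝ} (hεpos : 0 < ε) (hε : ∀ j, ε ≤ ν j * Torus.gradNormSq (u j)) :
    Tendsto (fun j => Torus.gradNormSq (u j)) atTop atTop := by
  have h1 : Tendsto ν atTop (𝓝[>] 0) :=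
    tendsto_nhdsWithin_iff.mpr ⟨hν0, Eventually.of_forall fun j => hν j⟩
  have h2 : Tendsto (fun j => (ν j)⁻¹) atTop atTop := tendsto_inv_nhdsGT_zero.comp h1
  have h3 : Tendsto (fun j => ε * (ν j)⁻¹) atTop atTop := h2.const_mul_atTop hεpos
  refine tendsto_atTop_mono (fun j => ?_) h3
  rw [← div_eq_mul_inv]
  exact enstrophy_ge hν hε j

/-- **Refuted trivial strengthening (proved): no single (`ν`-independent) steady state carries the
floor** — with `u_j = U` for all `j`, `ε ≤ ν_j‖∇U‖₂² → 0`. [folklore] -/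
theorem not_frozen_state {ν : ℕ → ℝ} (hν0 : Tendsto ν atTop (𝓝 0))
    (U : UnitAddTorus (Fin 3) → EuclideanSpace ℝ (Fin 3)) {ε : ℝ} (hεpos : 0 < ε)
    (hε : ∀ j, ε ≤ ν j * Torus.gradNormSq U) : False := by
  have h : Tendsto (fun j => ν j * Torus.gradNormSq U) atTop (𝓝 (0 * Torus.gradNormSq U)) :=
    hν0.mul_const _
  rw [zero_mul] at h
  have hev : ∀ᶠ j in atTop, ν j * Torus.gradNormSq U < ε := h (Iio_mem_nhds hεpos)
  obtain ⟨j, hj⟩ := hev.exists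
  exact absurd (hε j) (not_le.mpr hj)

/-! ## §2b–c Refuted strengthenings of the conclusion — landed lemmas, re-exported by name -/

/-- Weighted steady energy identity on `T^d`. Landed (p162118). [folklore] -/
alias steady_weighted_energy_identity := Summit.AnomalousDissipation.AnomalousDissipation.Theorems.SolitonTransplant.Negative.steady_weighted_energy_identity

/-- No bounded point sink. Landed (p162345). [folklore] -/
alias pointSink_dissipationFloor_false_of_bounded := Summit.AnomalousDissipation.AnomalousDissipation.Theorems.SolitonTransplant.Negative.pointSink_dissipationFloor_false_of_bounded

/-- `X` ∧ (bounded states and pressures) is false. Landed (p162345). [folklore] -/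
alias not_pointSinkZerothLaw_bounded := Summit.AnomalousDissipation.AnomalousDissipation.Theorems.SolitonTransplant.Negative.not_pointSinkZerothLaw_bounded

/-- No `L^q × L^{q/2}`-bounded point sink, `q > 9/2`. Landed (p163407). [folklore] -/
alias pointSink_dissipationFloor_false_of_LqBound := Summit.AnomalousDissipation.AnomalousDissipation.Theorems.SolitonTransplant.Negative.pointSink_dissipationFloor_false_of_LqBound

/-- `X` ∧ (`L^q × L^{q/2}`-bounded states, some `q > 9/2`) is false. Landed (p163407). [folklore] -/
alias not_pointSinkZerothLaw_LqBounded := Summit.AnomalousDissipation.AnomalousDissipation.Theorems.SolitonTransplant.Negative.not_pointSinkZerothLaw_LqBounded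

/-- No tame point sink (limit `C¹` off the sink, steady Euler there). Landed by an earlier seat (p142855). [folklore] -/
alias dissipationFloor_false_of_tame_singleton := Summit.AnomalousDissipation.AnomalousDissipation.Theorems.SolitonTransplant.Negative.dissipationFloor_false_of_tame_singleton

end Summit.AnomalousDissipation.AnomalousDissipation.Cruxes.SolitonTransplant.Disproof

end
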